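import Summits.QuantumFields.YangMills.Theorems.FluctuationComparisonRegPrIntLBeyondOneLoopInteriorGasDoor
import Summits.QuantumFields.YangMills.Theorems.FluctuationComparisonRegPrIntLKPGasOfGeometricActivities
import HarnessLib

/-!
# THE INTERIOR GEOMETRIC DOOR FOR ROW 2 OF THE S2β TABLE: activities on CONNECTED bond polymers bounded by `Φ_J·q^{|X|}` on the interior window, plus the gas identity
# `f¹ = c + F₀ + log Ξ(w)`, GIVE the REGISTERED interior row H4ᶜ∘ `BeyondOneLoopSmallIntCan` VERBATIM (letter ⟨GEO∘⟩ — print's native currency [Balaban1987RG1] (0.23)–(0.26))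

Cell `ym3-torus` (YM ladder rung R3 = continuum `SU(2)` Yang–Mills on the three-torus — a RUNG, NOT d = 4, NOT infinite volume, NOT a mass gap, NOT Clay).  Seat `ymfull-r3-prover-2`
(gen 0; R600-ym: hand = the REGISTERED stub `stub_beyondOneLoopSmallIntCan : BeyondOneLoopSmallIntCan`, registry `Cruxes/FluctuationComparisonRegPrIntL/Lines/semiclassical_s2beta.lean`
v11.4 `def` l.571 ∕ stub l.1580; PLAN `Lines/loop_ledger.lean` v6; lane per LEAD w3 g23 №4: «the KP-activity letters»); `--supports stmt-QuantumFields-20520 --as helper`, count-neutral,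
definition-free, default heartbeats; no registry, binder or `Lines/` edit (RULING №36 untouched).  Third of a chain: FILE 1 ✓p786380 `…BeyondOneLoopInteriorDoor` (⟨SCL∘⟩ → ⟨REP∘⟩ →
H4ᶜ∘), FILE 2 `…BeyondOneLoopInteriorGasDoor` (⟨GAS∘⟩ → ⟨REP∘⟩, ⟨ECE⟩ → H4ᶜ∘), KP letter №1 `…KPGasOfGeometricActivities` (connected support + `E₀q^{|X|}` ⟹ `KPGasOn`).

WHAT.  ⟨GEO∘⟩ («geometric gas on the interior window») = GAS∘ of LINE g19-2 (REP's prefix VERBATIM with the registry's two ∘-moves) in which the Kotecký–Preiss clause `KPGasOn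
window κ (Φ J) w` is REPLACED by the expansion's NATIVE output: structural constants `Δ, r, q` chosen with `κ` (`(Δ+1)²·q·e^{1+κr} ≤ ½`: decay per bond beats the animal entropy
— in print «κ can be made arbitrarily large by taking M large», [Balaban1987RG1] after (0.25)), then at every depth `J ≤ K` an adjacency `R` on the bonds of `(F.P J)₀` (symmetric,
`≤ Δ` listed neighbours, steps of source-`tdist` `≤ r` — e.g. «bonds of touching unit cubes»), a constant `c`, and real activities `w` with `w ∅ = 0`, V-LOCALITY, SUPPORT ON
`R`-CONNECTED POLYMERS and the bound `|w_U X| ≤ Φ_J·q^{|X|}` on the interior window (`0 ≤ Φ J ≤ 1`, `J·Φ J → 0`: `Φ J = O(g_J²)` per localisation in d = 3, [Balaban1985UV3]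
(45)–(47)), and the identity `f¹ U = c + F₀ U + log Ξ(w_U)` there (`F₀ = oneLoopPartCan`, a `limUnder`; `Ξ` the hard-core gas partition function over all bond polymers, `polyInc`).
* ★ `gasInt_of_geoInt : ⟨GEO∘⟩ → ⟨GAS∘⟩` — per depth, KP letter №1 ✓`kpGasOn_of_geometric` with `E₀ := N := Φ J`.
* ★★ `beyondOneLoopSmallInt_of_geoInt : ⟨SCL∘⟩ → ⟨GEO∘⟩ → ⟨BeyondOneLoopSmallIntCan VERBATIM⟩` — FILE 2's ✓`beyondOneLoopSmallInt_of_gasInt` after it; with FILE 1's ✓`sclInt_of_scl`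
  the loop-ledger SCL (✓ in-line from EXW + GAP♯) serves as ⟨SCL∘⟩.  So the REP hand's target for row 2 reads, Theorems-side and by name: «exhibit, on the interior window and at every
  depth, V-local activities on connected bond polymers with `|w_U X| ≤ Φ_J q^{|X|}` and `f¹ = c + F₀ + log Ξ(w)`» — the statement of [Balaban1987RG1] Thm 1 (0.23)–(0.26) read in d = 3
  for the `T³` tower, nothing more and nothing less.
Door-fit (HOME cert): `example : SemiclassicalLimitCan → ⟨GEO∘⟩ → BeyondOneLoopSmallIntCan` against the pasted registry v11.4 ∕ loop_ledger v6 texts.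

HONEST SCOPE.  Quantifier plumbing over KP letter №1 and FILE 2; ⟨GEO∘⟩ and ⟨SCL∘⟩ are HYPOTHESES (⟨GEO∘⟩ IS the XL small-field cluster expansion in identity form, nobody's theorem);
nothing of Bałaban's is asserted or proved; `BeyondOneLoopSmallIntCan`, the other four registered ∘-stubs, S2β and `FluctuationComparisonRegPrIntL` (stmt-QuantumFields-20520) are NOT
proved; no summit statement is proved by a helper; rung R3 = SU(2) YM₃ on T³ — finite volume, conditional; NOT d = 4, NOT infinite volume, NOT a mass gap, NOT Clay; the Yang–Mills
mass gap is NOT proved.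

References: T. Bałaban, CMP **109** (1987) 249–301 [Balaban1987RG1] (Thm 1, (0.22)–(0.26) pp.256–257); CMP **102** (1985) 255–275 [Balaban1985UV3] ((45)–(47) p.267); CMP **122** (1989)
355–392 [Balaban1989LargeFieldII] ((1.97)–(1.100) pp.389–390); R. Kotecký, D. Preiss, CMP **103** (1986) 491–498 [KoteckyPreiss1986].
-/

noncomputable section

open MeasureTheory Filter Topology Set
open Literature.Probability.LatticeModels (polymerPartitionFunction polyInc IsRConnected)
open Literature.MathematicalPhysics.QuantumFieldTheory.Balaban1983to89
open Literature.MathematicalPhysics.QuantumFieldTheory.Balaban1983to89.T3ContinuumYM3Torus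
open Literature.MathematicalPhysics.QuantumFieldTheory.Balaban1983to89.T3NestedUnitLaws
open Literature.MathematicalPhysics.QuantumFieldTheory.Balaban1983to89.T3UnitLawDensityEML
open Literature.MathematicalPhysics.QuantumFieldTheory.Balaban1983to89.T3UnitScaleTilt
open Literature.MathematicalPhysics.QuantumFieldTheory.Balaban1983to89.T3TiltDescent
open Literature.MathematicalPhysics.QuantumFieldTheory.Balaban1983to89.T3PrintedRegularMinimiser
open Summit.QuantumFields.YangMills.Theorems.BeyondOneLoopInteriorDoor
open Summit.QuantumFields.YangMills.Theorems.BeyondOneLoopInteriorGasDoor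
open Summit.QuantumFields.YangMills.Theorems.KPGasOfGeometricActivities

namespace Summit.QuantumFields.YangMills.Theorems.BeyondOneLoopInteriorGeometricDoor

open Classical in
/-- ★ **⟨GEO∘⟩ → ⟨GAS∘⟩**: at every depth the geometric activities form the Kotecký–Preiss gas of GAS∘ with one-bond size `Φ J` — KP letter №1 ✓`kpGasOn_of_geometric` with
`E₀ := N := Φ J` (`Φ J ≤ 1`); prefix and identity threaded unchanged. [cite: Balaban1987RG1, (0.23)-(0.26) pp.256-257; KoteckyPreiss1986, Theorem p.492 (1)] -/
theorem gasInt_of_geoInt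
    (hG : ∀ (L : ℕ), ∃ c₀ : ℝ, 0 < c₀ ∧ c₀ ≤ 1 ∧ ∀ (cw : ℝ), 0 < cw → cw ≤ c₀ →
      ∃ pS : ℝ, ∀ (b₀ p₀ : ℝ), 0 < b₀ → pS ≤ p₀ → 0 < p₀ → ∃ ε₁ : ℝ, 0 < ε₁ ∧ ∀ (ε₀ : ℝ), 0 < ε₀ → ε₀ ≤ ε₁ →
      ∃ γ₁ : ℝ, 0 < γ₁ ∧ ∃ κ : ℝ, 0 < κ ∧ ∃ (Δ : ℕ) (r q : ℝ), 0 ≤ r ∧ 0 ≤ q ∧ ((Δ : ℝ) + 1) ^ 2 * (q * Real.exp (1 + κ * r)) ≤ 1 / 2 ∧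
        ∀ (F : T3Family) (γ : ℝ), F.L = L → 0 < γ → γ ≤ γ₁ →
          ∃ Φ : ℕ → ℝ, (∀ J, 0 ≤ Φ J) ∧ (∀ J, Φ J ≤ 1) ∧ Tendsto (fun J : ℕ => (J : ℝ) * Φ J) atTop (𝓝 0) ∧
            ∀ (J K : ℕ) (hJK : J ≤ K),
              ∃ (c : ℝ) (R : PBond (F.P J) 0 → PBond (F.P J) 0 → Prop) (nbr : PBond (F.P J) 0 → Finset (PBond (F.P J) 0))
                (w : GaugeField (F.P J) 0 (Matrix.specialUnitaryGroup (Fin 2) ℂ) → Finset (PBond (F.P J) 0) → ℝ),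
                (∀ x y, R x y → R y x) ∧ (∀ x, (nbr x).card ≤ Δ) ∧ (∀ x y, R x y → y ∈ nbr x) ∧
                (∀ x y, R x y → ((x.src.tdist y.src : ℕ) : ℝ) ≤ r) ∧
                (∀ U, w U ∅ = 0) ∧
                (∀ (X : Finset (PBond (F.P J) 0)) (U U' : GaugeField (F.P J) 0 (Matrix.specialUnitaryGroup (Fin 2) ℂ)), (∀ e ∈ X, U e = U' e) → w U X = w U' X) ∧
                (∀ U, U ∈ {U : GaugeField (F.P J) 0 (Matrix.specialUnitaryGroup (Fin 2) ℂ) | PlaqSmall (θBal F.L γ (cw * b₀) p₀ J) U} → ∀ X, ¬ IsRConnected R X → w U X = 0) ∧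
                (∀ U, U ∈ {U : GaugeField (F.P J) 0 (Matrix.specialUnitaryGroup (Fin 2) ℂ) | PlaqSmall (θBal F.L γ (cw * b₀) p₀ J) U} → ∀ X, IsRConnected R X → |w U X| ≤ Φ J * q ^ X.card) ∧
                ∀ U : GaugeField (F.P J) 0 (Matrix.specialUnitaryGroup (Fin 2) ℂ), PlaqSmall (θBal F.L γ (cw * b₀) p₀ J) U →
                  (Real.log (Node00.canonVersion (fieldMeasure (F.P J) 0 (Matrix.specialUnitaryGroup (Fin 2) ℂ)) (heightDensity F (γ / 1) hJK (histGood F ℰp (θBal F.L γ b₀ p₀) K J)) U) + (F.scheme ℰp (γ / 1)).β K * minActionRegPr F J K hJK ε₀ U)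
                    = c + limUnder atTop (fun lam : ℝ => (Real.log (Node00.canonVersion (fieldMeasure (F.P J) 0 (Matrix.specialUnitaryGroup (Fin 2) ℂ)) (heightDensity F (γ / lam) hJK (histGood F ℰp (θBal F.L γ b₀ p₀) K J)) U) + (F.scheme ℰp (γ / lam)).β K * minActionRegPr F J K hJK ε₀ U)
                        - (Real.log (Node00.canonVersion (fieldMeasure (F.P J) 0 (Matrix.specialUnitaryGroup (Fin 2) ℂ)) (heightDensity F (γ / lam) hJK (histGood F ℰp (θBal F.L γ b₀ p₀) K J)) 1) + (F.scheme ℰp (γ / lam)).β K * minActionRegPr F J K hJK ε₀ 1))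
                      + Real.log (polymerPartitionFunction polyInc (fun X : Finset (PBond (F.P J) 0) => ((w U X : ℝ) : ℂ)) Finset.univ).re) :
    ∀ (L : ℕ), ∃ c₀ : ℝ, 0 < c₀ ∧ c₀ ≤ 1 ∧ ∀ (cw : ℝ), 0 < cw → cw ≤ c₀ →
      ∃ pS : ℝ, ∀ (b₀ p₀ : ℝ), 0 < b₀ → pS ≤ p₀ → 0 < p₀ → ∃ ε₁ : ℝ, 0 < ε₁ ∧ ∀ (ε₀ : ℝ), 0 < ε₀ → ε₀ ≤ ε₁ →
      ∃ γ₁ : ℝ, 0 < γ₁ ∧ ∃ κ : ℝ, 0 < κ ∧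
        ∀ (F : T3Family) (γ : ℝ), F.L = L → 0 < γ → γ ≤ γ₁ →
          ∃ Φ : ℕ → ℝ, (∀ J, 0 ≤ Φ J) ∧ Tendsto (fun J : ℕ => (J : ℝ) * Φ J) atTop (𝓝 0) ∧
            ∀ (J K : ℕ) (hJK : J ≤ K),
              ∃ (c : ℝ) (w : GaugeField (F.P J) 0 (Matrix.specialUnitaryGroup (Fin 2) ℂ) → Finset (PBond (F.P J) 0) → ℝ),
                (∃ (wbar a ℓ : Finset (PBond (F.P J) 0) → ℝ),
                (∀ U, w U ∅ = 0) ∧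
                (∀ (X : Finset (PBond (F.P J) 0)) (U U' : GaugeField (F.P J) 0 (Matrix.specialUnitaryGroup (Fin 2) ℂ)),
                  (∀ e ∈ X, U e = U' e) → w U X = w U' X) ∧
                (∀ X, 0 ≤ a X) ∧ (∀ X, 0 ≤ ℓ X) ∧
                (∀ U, U ∈ {U : GaugeField (F.P J) 0 (Matrix.specialUnitaryGroup (Fin 2) ℂ) | PlaqSmall (θBal F.L γ (cw * b₀) p₀ J) U} → ∀ X, |w U X| ≤ wbar X) ∧
                (∀ X : Finset (PBond (F.P J) 0), ∀ e ∈ X, ∀ e' ∈ X, (e.src.tdist e'.src : ℝ) ≤ ℓ X) ∧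
                (∀ X : Finset (PBond (F.P J) 0), ∑ X' ∈ Finset.univ.filter (fun X' => polyInc X' X),
                    wbar X' * Real.exp (a X' + κ * ℓ X') ≤ a X) ∧
                (∀ e : PBond (F.P J) 0, a {e} ≤ (Φ J))) ∧
                ∀ U : GaugeField (F.P J) 0 (Matrix.specialUnitaryGroup (Fin 2) ℂ), PlaqSmall (θBal F.L γ (cw * b₀) p₀ J) U →
                  (Real.log (Node00.canonVersion (fieldMeasure (F.P J) 0 (Matrix.specialUnitaryGroup (Fin 2) ℂ))
                      (heightDensity F (γ / 1) hJK (histGood F ℰp (θBal F.L γ b₀ p₀) K J)) U)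
                    + (F.scheme ℰp (γ / 1)).β K * minActionRegPr F J K hJK ε₀ U)
                    = c + limUnder atTop (fun lam : ℝ => (Real.log (Node00.canonVersion (fieldMeasure (F.P J) 0 (Matrix.specialUnitaryGroup (Fin 2) ℂ))
                      (heightDensity F (γ / lam) hJK (histGood F ℰp (θBal F.L γ b₀ p₀) K J)) U)
                    + (F.scheme ℰp (γ / lam)).β K * minActionRegPr F J K hJK ε₀ U) - (Real.log (Node00.canonVersion (fieldMeasure (F.P J) 0 (Matrix.specialUnitaryGroup (Fin 2) ℂ))
                      (heightDensity F (γ / lam) hJK (histGood F ℰp (θBal F.L γ b₀ p₀) K J)) 1)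
                    + (F.scheme ℰp (γ / lam)).β K * minActionRegPr F J K hJK ε₀ 1))
                      + Real.log (polymerPartitionFunction polyInc (fun X : Finset (PBond (F.P J) 0) => ((w U X : ℝ) : ℂ)) Finset.univ).re := by
  intro L
  obtain ⟨c₀, hc₀, hc₀1, H⟩ := hG L
  refine ⟨c₀, hc₀, hc₀1, fun cw hcw hcwle => ?_⟩
  obtain ⟨pS, H0⟩ := H cw hcw hcwle
  refine ⟨pS, fun b₀ p₀ hb hp hp0 => ?_⟩
  obtain ⟨ε₁, hε₁, H1⟩ := H0 b₀ p₀ hb hp hp0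
  refine ⟨ε₁, hε₁, fun ε₀ hε₀ hε₀le => ?_⟩
  obtain ⟨γ₁, hγ₁, κ, hκ, Δ, r, q, hr, hq, hsmall, H2⟩ := H1 ε₀ hε₀ hε₀le
  refine ⟨γ₁, hγ₁, κ, hκ, fun F γ hFL hγ hγle => ?_⟩
  obtain ⟨Φ, hΦ0, hΦ1, hΦ, H3⟩ := H2 F γ hFL hγ hγle
  refine ⟨Φ, hΦ0, hΦ, fun J K hJK => ?_⟩
  obtain ⟨c, R, nbr, w, hRs, hΔ, hnbr, hRr, hw0, hloc, hsupp, hbd, hid⟩ := H3 J K hJK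
  exact ⟨c, w, kpGasOn_of_geometric R hRs nbr Δ hΔ hnbr hr hRr _ w hw0 hloc hsupp (hΦ0 J) le_rfl (hΦ1 J) hq hκ.le hsmall hbd, hid⟩

open Classical in
/-- ★★ **⟨SCL∘⟩ → ⟨GEO∘⟩ → H4ᶜ∘ `BeyondOneLoopSmallIntCan` VERBATIM** — FILE 2's ✓`beyondOneLoopSmallInt_of_gasInt` after `gasInt_of_geoInt`.  The REP hand's row-2 target in print's
native currency: V-local activities on connected bond polymers, `|w_U X| ≤ Φ_J q^{|X|}` on the interior window, `f¹ = c + F₀ + log Ξ(w)`.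
[cite: Balaban1985UV3, (45)-(47) p.267; Balaban1987RG1, Thm 1 (0.19)-(0.26) pp.255-257] -/
theorem beyondOneLoopSmallInt_of_geoInt
    (hS : ∀ (L : ℕ), ∃ c₀ : ℝ, 0 < c₀ ∧ c₀ ≤ 1 ∧ ∀ (cw : ℝ), 0 < cw → cw ≤ c₀ →
      ∃ pS : ℝ, ∀ (b₀ p₀ : ℝ), 0 < b₀ → pS ≤ p₀ → 0 < p₀ → ∃ ε₁ : ℝ, 0 < ε₁ ∧ ∀ (ε₀ : ℝ), 0 < ε₀ → ε₀ ≤ ε₁ →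
      ∃ γ₁ : ℝ, 0 < γ₁ ∧ ∀ (F : T3Family) (γ : ℝ), F.L = L → 0 < γ → γ ≤ γ₁ →
        ∀ (J K : ℕ) (hJK : J ≤ K) (V : GaugeField (F.P J) 0 (Matrix.specialUnitaryGroup (Fin 2) ℂ)), PlaqSmall (θBal F.L γ (cw * b₀) p₀ J) V →
          ∃ a : ℝ, Tendsto (fun lam : ℝ =>
            (Real.log (Node00.canonVersion (fieldMeasure (F.P J) 0 (Matrix.specialUnitaryGroup (Fin 2) ℂ)) (heightDensity F (γ / lam) hJK (histGood F ℰp (θBal F.L γ b₀ p₀) K J)) V) + (F.scheme ℰp (γ / lam)).β K * minActionRegPr F J K hJK ε₀ V)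
            - (Real.log (Node00.canonVersion (fieldMeasure (F.P J) 0 (Matrix.specialUnitaryGroup (Fin 2) ℂ)) (heightDensity F (γ / lam) hJK (histGood F ℰp (θBal F.L γ b₀ p₀) K J)) 1) + (F.scheme ℰp (γ / lam)).β K * minActionRegPr F J K hJK ε₀ 1)) atTop (𝓝 a))
    (hG : ∀ (L : ℕ), ∃ c₀ : ℝ, 0 < c₀ ∧ c₀ ≤ 1 ∧ ∀ (cw : ℝ), 0 < cw → cw ≤ c₀ →
      ∃ pS : ℝ, ∀ (b₀ p₀ : ℝ), 0 < b₀ → pS ≤ p₀ → 0 < p₀ → ∃ ε₁ : ℝ, 0 < ε₁ ∧ ∀ (ε₀ : ℝ), 0 < ε₀ → ε₀ ≤ ε₁ →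
      ∃ γ₁ : ℝ, 0 < γ₁ ∧ ∃ κ : ℝ, 0 < κ ∧ ∃ (Δ : ℕ) (r q : ℝ), 0 ≤ r ∧ 0 ≤ q ∧ ((Δ : ℝ) + 1) ^ 2 * (q * Real.exp (1 + κ * r)) ≤ 1 / 2 ∧
        ∀ (F : T3Family) (γ : ℝ), F.L = L → 0 < γ → γ ≤ γ₁ →
          ∃ Φ : ℕ → ℝ, (∀ J, 0 ≤ Φ J) ∧ (∀ J, Φ J ≤ 1) ∧ Tendsto (fun J : ℕ => (J : ℝ) * Φ J) atTop (𝓝 0) ∧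
            ∀ (J K : ℕ) (hJK : J ≤ K),
              ∃ (c : ℝ) (R : PBond (F.P J) 0 → PBond (F.P J) 0 → Prop) (nbr : PBond (F.P J) 0 → Finset (PBond (F.P J) 0))
                (w : GaugeField (F.P J) 0 (Matrix.specialUnitaryGroup (Fin 2) ℂ) → Finset (PBond (F.P J) 0) → ℝ),
                (∀ x y, R x y → R y x) ∧ (∀ x, (nbr x).card ≤ Δ) ∧ (∀ x y, R x y → y ∈ nbr x) ∧
                (∀ x y, R x y → ((x.src.tdist y.src : ℕ) : ℝ) ≤ r) ∧
                (∀ U, w U ∅ = 0) ∧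
                (∀ (X : Finset (PBond (F.P J) 0)) (U U' : GaugeField (F.P J) 0 (Matrix.specialUnitaryGroup (Fin 2) ℂ)), (∀ e ∈ X, U e = U' e) → w U X = w U' X) ∧
                (∀ U, U ∈ {U : GaugeField (F.P J) 0 (Matrix.specialUnitaryGroup (Fin 2) ℂ) | PlaqSmall (θBal F.L γ (cw * b₀) p₀ J) U} → ∀ X, ¬ IsRConnected R X → w U X = 0) ∧
                (∀ U, U ∈ {U : GaugeField (F.P J) 0 (Matrix.specialUnitaryGroup (Fin 2) ℂ) | PlaqSmall (θBal F.L γ (cw * b₀) p₀ J) U} → ∀ X, IsRConnected R X → |w U X| ≤ Φ J * q ^ X.card) ∧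
                ∀ U : GaugeField (F.P J) 0 (Matrix.specialUnitaryGroup (Fin 2) ℂ), PlaqSmall (θBal F.L γ (cw * b₀) p₀ J) U →
                  (Real.log (Node00.canonVersion (fieldMeasure (F.P J) 0 (Matrix.specialUnitaryGroup (Fin 2) ℂ)) (heightDensity F (γ / 1) hJK (histGood F ℰp (θBal F.L γ b₀ p₀) K J)) U) + (F.scheme ℰp (γ / 1)).β K * minActionRegPr F J K hJK ε₀ U)
                    = c + limUnder atTop (fun lam : ℝ => (Real.log (Node00.canonVersion (fieldMeasure (F.P J) 0 (Matrix.specialUnitaryGroup (Fin 2) ℂ)) (heightDensity F (γ / lam) hJK (histGood F ℰp (θBal F.L γ b₀ p₀) K J)) U) + (F.scheme ℰp (γ / lam)).β K * minActionRegPr F J K hJK ε₀ U)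
                        - (Real.log (Node00.canonVersion (fieldMeasure (F.P J) 0 (Matrix.specialUnitaryGroup (Fin 2) ℂ)) (heightDensity F (γ / lam) hJK (histGood F ℰp (θBal F.L γ b₀ p₀) K J)) 1) + (F.scheme ℰp (γ / lam)).β K * minActionRegPr F J K hJK ε₀ 1))
                      + Real.log (polymerPartitionFunction polyInc (fun X : Finset (PBond (F.P J) 0) => ((w U X : ℝ) : ℂ)) Finset.univ).re) :
    ∀ (L : ℕ), ∃ c₀ : ℝ, 0 < c₀ ∧ c₀ ≤ 1 ∧ ∀ (c : ℝ), 0 < c → c ≤ c₀ → ∃ pS : ℝ, ∀ (b₀ p₀ : ℝ), 0 < b₀ → pS ≤ p₀ → 0 < p₀ →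
      ∃ ε₁ : ℝ, 0 < ε₁ ∧ ∀ (ε₀ : ℝ), 0 < ε₀ → ε₀ ≤ ε₁ →
      ∃ γ₁ : ℝ, 0 < γ₁ ∧ ∃ κ : ℝ, 0 < κ ∧ ∀ (F : T3Family) (γ : ℝ), F.L = L → 0 < γ → γ ≤ γ₁ →
        ∃ φ₂ : ℕ → ℝ, (∀ J, 0 ≤ φ₂ J) ∧ Tendsto (fun J : ℕ => (J : ℝ) * φ₂ J) atTop (𝓝 0) ∧
          ∀ (J K : ℕ) (hJK : J ≤ K) (b b' : PBond (F.P J) 0) (U V W Z : GaugeField (F.P J) 0 (Matrix.specialUnitaryGroup (Fin 2) ℂ)),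
            PlaqSmall (θBal F.L γ (c * b₀) p₀ J) U → PlaqSmall (θBal F.L γ (c * b₀) p₀ J) V →
            PlaqSmall (θBal F.L γ (c * b₀) p₀ J) W → PlaqSmall (θBal F.L γ (c * b₀) p₀ J) Z →
            (∀ e, e ≠ b → U e = V e) → (∀ e, e ≠ b' → U e = W e) → (∀ e, e ≠ b' → V e = Z e) → (∀ e, e ≠ b → W e = Z e) →
            |(((Real.log (Node00.canonVersion (fieldMeasure (F.P J) 0 (Matrix.specialUnitaryGroup (Fin 2) ℂ)) (heightDensity F (γ / 1) hJK (histGood F ℰp (θBal F.L γ b₀ p₀) K J)) U) + (F.scheme ℰp (γ / 1)).β K * minActionRegPr F J K hJK ε₀ U)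
                - (Real.log (Node00.canonVersion (fieldMeasure (F.P J) 0 (Matrix.specialUnitaryGroup (Fin 2) ℂ)) (heightDensity F (γ / 1) hJK (histGood F ℰp (θBal F.L γ b₀ p₀) K J)) V) + (F.scheme ℰp (γ / 1)).β K * minActionRegPr F J K hJK ε₀ V))
              - ((Real.log (Node00.canonVersion (fieldMeasure (F.P J) 0 (Matrix.specialUnitaryGroup (Fin 2) ℂ)) (heightDensity F (γ / 1) hJK (histGood F ℰp (θBal F.L γ b₀ p₀) K J)) W) + (F.scheme ℰp (γ / 1)).β K * minActionRegPr F J K hJK ε₀ W)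
                - (Real.log (Node00.canonVersion (fieldMeasure (F.P J) 0 (Matrix.specialUnitaryGroup (Fin 2) ℂ)) (heightDensity F (γ / 1) hJK (histGood F ℰp (θBal F.L γ b₀ p₀) K J)) Z) + (F.scheme ℰp (γ / 1)).β K * minActionRegPr F J K hJK ε₀ Z)))
              - limUnder atTop (fun lam : ℝ =>
                ((Real.log (Node00.canonVersion (fieldMeasure (F.P J) 0 (Matrix.specialUnitaryGroup (Fin 2) ℂ)) (heightDensity F (γ / lam) hJK (histGood F ℰp (θBal F.L γ b₀ p₀) K J)) U) + (F.scheme ℰp (γ / lam)).β K * minActionRegPr F J K hJK ε₀ U)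
                  - (Real.log (Node00.canonVersion (fieldMeasure (F.P J) 0 (Matrix.specialUnitaryGroup (Fin 2) ℂ)) (heightDensity F (γ / lam) hJK (histGood F ℰp (θBal F.L γ b₀ p₀) K J)) V) + (F.scheme ℰp (γ / lam)).β K * minActionRegPr F J K hJK ε₀ V))
                - ((Real.log (Node00.canonVersion (fieldMeasure (F.P J) 0 (Matrix.specialUnitaryGroup (Fin 2) ℂ)) (heightDensity F (γ / lam) hJK (histGood F ℰp (θBal F.L γ b₀ p₀) K J)) W) + (F.scheme ℰp (γ / lam)).β K * minActionRegPr F J K hJK ε₀ W)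
                  - (Real.log (Node00.canonVersion (fieldMeasure (F.P J) 0 (Matrix.specialUnitaryGroup (Fin 2) ℂ)) (heightDensity F (γ / lam) hJK (histGood F ℰp (θBal F.L γ b₀ p₀) K J)) Z) + (F.scheme ℰp (γ / lam)).β K * minActionRegPr F J K hJK ε₀ Z)))|
              ≤ φ₂ J * Real.exp (-(κ * (b.src.tdist b'.src : ℝ))) :=
  beyondOneLoopSmallInt_of_gasInt hS (gasInt_of_geoInt hG)

end Summit.QuantumFields.YangMills.Theorems.BeyondOneLoopInteriorGeometricDoor

end
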